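import Summits.Langlands.Langlands.Theses.OrdinaryPrimeTransport
import Summits.Langlands.Langlands.Theorems.WachComponentCensusLiftB2UnramSplitPInPrint
import HarnessLib

/-!
# Line `OneComplexPlaceSatakeA2` — G4 ladder-down rung (generation 38) on the crux `ReciprocityUpToIrreducibility`
# (item stmt-Langlands-14328; routes IrreducibilityBySelfDuality (primary) and OrdinaryPrimeTransport — this file targets BY NAME the
# `Iff.rfl`-equal copy `…Theses.OrdinaryPrimeTransport.ReciprocityUpToIrreducibility`, which carries the SAME item; the
# IBSD module could not be served coherently by the workfile farm at filing time)

TOP `E` = `Summit.Langlands.Langlands.Theses.OrdinaryPrimeTransport.ReciprocityUpToIrreducibility` (`Langlands ↔ E`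
landed: `Theorems.IrreducibleOffSector.langlands_iff_reciprocityUpToIrreducibility_of_JS`; `Langlands → E ∧ …`
unconditional: `Theorems.ReciprocityUpToIrreducibility.langlands_iff_reciprocityUpToIrreducibility_and_irreducible`).

DIAL (in `E`'s own language — clause (A) automorphic → Galois, `n = 2`, regular `L`-algebraic `π`, conclusion at the
a.e. SATAKE level `SatakeFrobCompatibleAE ι π.1 ρ` = the first conjunct of `Corresponds`): the NUMBER OF COMPLEX PLACES
`c` of the base field `K`, for `K` in the QUADRATIC WINDOW (`K ⊃ F`, `F` totally real, `[K:F] = 2`; these are the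
totally real, the CM, and the mixed-signature quadratic-over-totally-real fields).
* `c = 0`: `K` totally real — FLOOR = lang.S27 at `n = 2` (Carayol, Taylor, Blasius–Rogawski; the tree's named fact
  `Literature.NumberTheory.Automorphic.exists_galoisRep_of_regularAlgebraic`), PROVED here: `floor_zero` (half-twist
  renormalisation, the proof of `Theorems.exists_irreducible_satakeFrobCompatibleAE_GL2`).
* `c = 1`: THE RUNG `OneComplexPlaceSatakeA2 = WindowSatakeA2 1` — every window field with at most one complex place:
  totally real (floor), imaginary quadratic (CM: lang.S27 again, `cmCell`; Harris–Soudry–Taylor 1993, Taylor 1994,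
  Berger–Harcos 2007), and the MIXED ONE-COMPLEX-PLACE WINDOWS `K = F(√α)`, `[F:ℚ] ≥ 2`, `α ∈ F` negative at exactly one
  real place (signature `(2[F:ℚ]-2, 1)`, e.g. `ℚ(√(1+√2))`) — OPEN; given lang.S27 the rung is EQUIVALENT to this mixed
  core (`rung_of_mixed`, `mixed_of_rung`, sorry-free).  LOCATED STOP, in print: no Galois representation has been
  attached to a regular algebraic cusp form of `GL₂` over a number field that is neither totally real nor CM
  (Goldring, *Introduction to the Langlands correspondence* §4.4.3 "Other number fields … there is no known way to
  directly relate `π` to the cohomology of an algebraic variety" = `Literature.Barriers.Langlands.ShimuraVarietyRealizationBarrier`;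
  Calegari arXiv:2109.14145 p. 24; Mok, Compositio 150 (2014) Thm. 1.1: `E/F` CM only, under (Char)); the imaginary
  quadratic proofs (theta lift of `AI(π)` to `GSp₄/ℚ`, holomorphic LIMIT-of-discrete-series Siegel forms, congruences
  to cohomological weight, pseudo-representations) were never run for a mixed `K/F`, where `AI_{K/F}(π)` is discrete
  series at the `[F:ℚ]-1` split real places and a non-degenerate limit of discrete series at the ONE non-split place:
  the host is a holomorphic Hilbert–Siegel form over `F` of weight singular at exactly one place, to which
  Goldring–Koskivirta (Invent. Math. 217 (2019), Thm. 10.5.1: Galois pseudo-representations for non-degenerate LDS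
  coherent cohomology of Hodge-type Shimura varieties) now attaches `ρ_Π : Γ_F → GL₄`; what is NOT in print is the
  assembly over a mixed `K/F`: (i) the symplectic/orthogonal alternative for `AI_{K/F}(π)` (Arthur 2013 / Gee–Taïbi
  for `GSp₄`; needs the central character of `π` to descend to `F` up to the quadratic character — Mok's (Char),
  whose archimedean sign condition is AUTOMATIC when exactly one real place of `F` is non-split), (ii) the extraction
  `ρ_Π|_{Γ_K} ≅ ρ ⊕ ρ^τ` with cofinite Satake matching (Taylor 1994 §3 / Berger–Harcos / the tree's PROVED
  `Theorems.TwistUnpackaging_proof` of route QuadraticWindow, which is stated for exactly this window), (iii) the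
  sub-cell where the central character does NOT descend (no symplectic host; proposed: quadratic base change `K·F'`
  to a `c = 2` window where it does, then cyclic descent of `ρ` — an honest open point, `Why it might fail`).
* `c ≥ 2`: the higher cells `HigherWindows` (several non-split places: Mok's sign condition becomes a genuine
  constraint; up to the CM cell `c = [F:ℚ]`, which is lang.S27 again).
NEAREST ROUTE: `QuadraticWindow` (τ-POLARIZED regular `π` on `GL_n` over the same window, unitary host `U(n,n)`,
all `n`); at `n = 2` "τ-polarized" means `π^τ ≅ π ⊗ μ` — a thin special class — so this rung (ALL regular `π` on
`GL₂`, symplectic host `GSp₄/F`) is the complementary generic sector at `n = 2`; no item of that route, of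
`TorsionKudlaMillsonWindow` (torsion classes, `GaloisRepWindowB`/`ConjAWindowTheta`) or of `EisensteinMonodromy`
(CM, local–global compatibility) states it.

LINE SHAPE (four registered stubs; composition sorry-free, §6/§8): `stub_rung : OneComplexPlaceSatakeA2` →
`stub_higherWindows : HigherWindows` → `stub_windowUpgrade : WindowUpgrade` (a.e. Satake ⟹ `IsGeometricFramed ∧ Corresponds`
for every `Rec` on the window sector: de Rham at `ℓ`, local–global compatibility everywhere — honest, open for congruence-built
`ρ`) → `stub_offWindow : OffWindowReciprocity` (E off the window sector: the declared residual) →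
`ReciprocityUpToIrreducibility_of … : E` BY NAME.  §4: `E → every cell` and `Langlands → every cell` (sorry-free; the on-path
lemma `OneComplexPlaceSatakeA2_of_Langlands`).
-/

noncomputable section

set_option linter.dupNamespace false

open scoped MatrixGroups Matrix NumberField
open NumberField IsDedekindDomain Field Filter Polynomial
open Literature.NumberTheory.Automorphic Literature.NumberTheory.GaloisRepresentations
open Literature.NumberTheory.PAdicHodge
open Summit.Langlands

namespace Summit.Langlands.Langlands.Cruxes.ReciprocityUpToIrreducibility.OneComplexPlaceSatakeA2

/-! ## 1. The cell body — clause (A) of `E` at SATAKE level, `n = 2`, regular `L`-algebraic `π` -/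

/-- **Cell body** (`E`'s clause (A) with `IsGeometricFramed Rec ρ ∧ Corresponds Rec ι π.1 ρ` weakened to
its first, `Rec`-free conjunct `SatakeFrobCompatibleAE ι π.1 ρ` — a.e. Satake/Frobenius compatibility in the
summit's `L`-normalisation `m = 1` — and `π` restricted to `GL₂` and to REGULAR infinity type): for every
level datum, every cuspidal `π` of `GL₂(𝔸_K)` which is `L`-algebraic and regular, every `ℓ` and
`ι : ℚ̄_ℓ ≃ ℂ`, there is a continuous `ρ : Γ_K → GL₂(ℚ̄_ℓ)` with
`char(ρ(Frob_v)) = ∏ (X - ι⁻¹(α_j⁻¹))` at almost every finite place `v` (`α` the Satake parameter). -/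
def RegularSatakeA2 (K : Type) [Field K] [NumberField K] : Prop :=
  ∀ (hcpt : isCompact_glFiniteIntegralLevel 2 K) (π : CuspidalAutomorphicRepData 2 K hcpt),
    π.1.IsLAlgebraic → (∃ T : InfinityType K 2, π.1.HasInfinityType T ∧ T.IsRegular) →
      ∀ (ℓ : ℕ) [Fact ℓ.Prime] (ι : PadicAlgCl ℓ ≃+* ℂ),
        ∃ ρ : FramedGaloisRep K (PadicAlgCl ℓ) 2, SatakeFrobCompatibleAE ι π.1 ρ

/-- **The quadratic window** (the sector convention of routes `QuadraticWindow` / `TorsionKudlaMillsonWindow`):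
`K` is a quadratic extension of a totally real field `F`.  Such `K` are exactly: totally real (`c = 0`
complex places), CM (`c = [F:ℚ]`), or of MIXED signature `(2[F:ℚ] - 2c, c)` with `1 ≤ c ≤ [F:ℚ] - 1`
(e.g. `ℚ(√(1+√2)) ⊃ ℚ(√2)`, signature `(2,1)`). -/
def IsQuadraticWindow (K : Type) [Field K] [NumberField K] : Prop :=
  ∃ (F : Type) (_ : Field F) (_ : NumberField F) (_ : Algebra F K), IsTotallyReal F ∧ Module.finrank F K = 2

/-! ## 2. The graded family (dial = number of complex places of the window field) and the rung -/

/-- **The family** `WindowSatakeA2 c`: the cell body over every window field `K ⊃ F` (`F` totally real,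
`[K:F] = 2`) with AT MOST `c` COMPLEX PLACES.  `c = 0`: `K` totally real — the FLOOR (Carayol, Taylor,
Blasius–Rogawski = lang.S27 at `n = 2`, `floor_zero`); `c = 1`: THE RUNG; `c ≥ 2`: the higher cells
(`HigherWindows`); `c ≥ [F:ℚ]` contains the CM cell (lang.S27, `cmCell`). Antitone in `c` (`mono`). -/
def WindowSatakeA2 (c : ℕ) : Prop :=
  ∀ (F K : Type) [Field F] [NumberField F] [Field K] [NumberField K] [Algebra F K],
    IsTotallyReal F → Module.finrank F K = 2 → NumberField.InfinitePlace.nrComplexPlaces K ≤ c →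
      RegularSatakeA2 K

/-- **THE RUNG** `OneComplexPlaceSatakeA2 := WindowSatakeA2 1`: Galois representations (a.e. Satake level,
`L`-normalisation) for regular `L`-algebraic cuspidal `π` on `GL₂` over every quadratic-over-totally-real
field with at most ONE complex place — i.e. over totally real fields (known), imaginary quadratic fields
(known: Harris–Soudry–Taylor, Taylor, Berger–Harcos; lang.S27) and the MIXED one-complex-place windows
`K = F(√α)`, `F ≠ ℚ` totally real, `α` negative at exactly one real place of `F` (OPEN — the content). -/
def OneComplexPlaceSatakeA2 : Prop := WindowSatakeA2 1

theorem rung_iff_family_one : OneComplexPlaceSatakeA2 ↔ WindowSatakeA2 1 := Iff.rfl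

/-- The family is antitone in the dial: a larger `c` allows more fields. -/
theorem mono {c c' : ℕ} (hle : c ≤ c') (h : WindowSatakeA2 c') : WindowSatakeA2 c :=
  fun F K _ _ _ _ _ hF hdeg hc => h F K hF hdeg (hc.trans hle)

/-- Rung ⇒ floor cell. -/
theorem floor_of_rung (h : OneComplexPlaceSatakeA2) : WindowSatakeA2 0 := mono (Nat.zero_le 1) h

/-! ## 3. The floor and the CM cells ARE the tree's named fact lang.S27 (sorry-free) -/

/-- **The cell body over a totally real or CM field, from lang.S27** (`exists_galoisRep_of_regularAlgebraic`:
Harris–Lan–Taylor–Thorne / Scholze; at `n = 2` Carayol–Taylor–Blasius–Rogawski over totally real `K` and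
Harris–Soudry–Taylor–Berger–Harcos–Mok over CM `K`), by the half-twist `π ↦ π ⊗ |det|^{1/2}` (regular
algebraic; Satake parameters scale by `q_v^{-1/2}`, which converts lang.S27's unitary normalisation
`∏ (X - ι⁻¹((q^{1/2} β_j)⁻¹))` into the summit's `∏ (X - ι⁻¹(α_j⁻¹))`).  The proof is the one of
`Theorems.exists_irreducible_satakeFrobCompatibleAE_GL2` with Ribet's irreducibility dropped and the
totally-real hypothesis relaxed to lang.S27's `IsTotallyReal K ∨ IsCMField K`. [folklore] -/
theorem regularSatakeA2_of_S27 (h27 : exists_galoisRep_of_regularAlgebraic)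
    {K : Type} [Field K] [NumberField K] (hK : IsTotallyReal K ∨ IsCMField K) : RegularSatakeA2 K := by
  intro hcpt π hL hreg ℓ _ ι
  obtain ⟨T', hT', hT'L⟩ := hL
  obtain ⟨T, hT, hTreg⟩ := hreg
  -- the `a`-multisets of two infinity types of `π` agree, so `T'` is regular as well
  have hT'reg : T'.IsRegular := fun σ => by
    rw [← AutomorphicRepData.HasInfinityType.map_a_eq π.1 hT hT' σ]
    exact hTreg σ
  -- the half-twist `πt = π ⊗ |det|^{1/2}` is regular algebraic (Clozel)
  obtain ⟨χ, πt, hχ, hW, hW', hPiT⟩ := π.exists_twist_hasInfinityType (1 / 2 : ℝ) hT'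
  have hPialg : πt.1.IsRegularAlgebraic := by
    refine ⟨T'.twist ((1 / 2 : ℝ) : ℂ), hPiT, ?_, hT'reg.twist _⟩
    rw [InfinityType.isCAlgebraic_iff_isLAlgebraic_twist, InfinityType.twist_twist]
    convert (InfinityType.isLAlgebraic_twist_intCast_iff T' 1).mpr hT'L using 2
    push_cast
    ring
  obtain ⟨r, -, hr⟩ := h27 hcpt hK πt hPialg ℓ ι
  refine ⟨r, ?_⟩
  -- the finitely many places above `ℓ`
  have hℓ0 : Ideal.span {((ℓ : ℕ) : 𝓞 K)} ≠ ⊥ := by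
    rw [Ne, Ideal.span_singleton_eq_bot]
    exact_mod_cast (Fact.out : ℓ.Prime).ne_zero
  have hfin : ∀ᶠ v : HeightOneSpectrum (𝓞 K) in cofinite, ((ℓ : ℕ) : 𝓞 K) ∉ v.asIdeal := by
    rw [Filter.eventually_cofinite]
    refine (Ideal.finite_factors hℓ0).subset fun v hv => ?_
    simp only [Set.mem_setOf_eq, not_not] at hv
    exact Ideal.dvd_span_singleton.mpr hv
  have hunr : ∀ᶠ v : HeightOneSpectrum (𝓞 K) in cofinite, π.1.IsUnramifiedAt v :=
    π.1.hasSatakeParamAt_cofinite_holds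
  have hq : ∀ v : HeightOneSpectrum (𝓞 K), (v.residueCard : ℂ) ≠ 0 := fun v =>
    Nat.cast_ne_zero.mpr (lt_trans zero_lt_one v.one_lt_residueCard).ne'
  unfold SatakeFrobCompatibleAE
  filter_upwards [hunr, hfin] with v hv hvℓ
  obtain ⟨α, hα⟩ := hv
  have hPiα := AutomorphicRepData.HasSatakeParamAt.of_map_mulChar_detTwist_of_cpow hχ hW hW' hα
  obtain ⟨hur, hcp⟩ := hr v _ hPiα hvℓ
  refine ⟨α, hα, hur, ?_⟩
  -- `∏ (X - ι⁻¹((q^{1/2} · q^{-1/2} a)⁻¹)) = ∏ (X - ι⁻¹(a⁻¹))`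
  have hs : ((Real.sqrt (v.residueCard : ℝ) : ℝ) : ℂ) =
      (v.residueCard : ℂ) ^ (((1 / 2 : ℝ) : ℝ) : ℂ) := by
    rw [Real.sqrt_eq_rpow, Complex.ofReal_cpow (Nat.cast_nonneg _)]
    push_cast
    rfl
  have key : arithFrobPolyOfSatake ι v.residueCard 2
      (α.map (((v.residueCard : ℂ) ^ (-(((1 / 2 : ℝ) : ℝ) : ℂ))) * ·)) =
      arithFrobPolyOfSatake ι v.residueCard 1 α := by
    unfold arithFrobPolyOfSatake
    rw [Multiset.map_map]
    congr 1
    refine Multiset.map_congr rfl fun a _ => ?_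
    simp only [Function.comp_apply]
    congr 3
    rw [hs, show (2 - 1 : ℕ) = 1 from rfl, show (1 - 1 : ℕ) = 0 from rfl, pow_one, pow_zero,
      one_mul, ← mul_assoc, ← Complex.cpow_add _ _ (hq v), add_neg_cancel, Complex.cpow_zero,
      one_mul]
  rw [← key]
  exact hcp

/-- **THE FLOOR `c = 0` IS lang.S27** (a window field with no complex place is totally real,
`NumberField.nrComplexPlaces_eq_zero_iff`). [folklore] -/
theorem floor_zero (h27 : exists_galoisRep_of_regularAlgebraic) : WindowSatakeA2 0 := by
  intro F K _ _ _ _ _ _ _ hc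
  have hK : IsTotallyReal K := NumberField.nrComplexPlaces_eq_zero_iff.mp (Nat.le_zero.mp hc)
  exact regularSatakeA2_of_S27 h27 (Or.inl hK)

/-- **The CM cells are lang.S27 too**: every window field that is CM (the imaginary quadratic fields at
`c = 1`; the top cell `c = [F:ℚ]` of every `F`) — so the rung's OPEN content is exactly the mixed windows.
[folklore] -/
theorem cmCell (h27 : exists_galoisRep_of_regularAlgebraic) {K : Type} [Field K] [NumberField K]
    (hK : IsCMField K) : RegularSatakeA2 K :=
  regularSatakeA2_of_S27 h27 (Or.inr hK)

/-- **The open core of the rung, isolated**: the MIXED one-complex-place windows (`K` a quadratic extension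
of a totally real `F` with exactly one complex place and NOT CM, i.e. `[F:ℚ] ≥ 2`; signature
`(2[F:ℚ]-2, 1)`). -/
def MixedOneComplexPlaceSatakeA2 : Prop :=
  ∀ (F K : Type) [Field F] [NumberField F] [Field K] [NumberField K] [Algebra F K],
    IsTotallyReal F → Module.finrank F K = 2 → NumberField.InfinitePlace.nrComplexPlaces K = 1 →
      ¬ IsCMField K → RegularSatakeA2 K

/-- **Rung = floor (lang.S27) + imaginary-quadratic cell (lang.S27) + mixed core** (sorry-free glue): given
lang.S27, the rung is EQUIVALENT to its mixed core. [folklore] -/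
theorem rung_of_mixed (h27 : exists_galoisRep_of_regularAlgebraic) (hmix : MixedOneComplexPlaceSatakeA2) :
    OneComplexPlaceSatakeA2 := by
  intro F K _ _ _ _ _ hF hdeg hc
  rcases Nat.le_one_iff_eq_zero_or_eq_one.mp hc with h0 | h1
  · exact regularSatakeA2_of_S27 h27 (Or.inl (NumberField.nrComplexPlaces_eq_zero_iff.mp h0))
  · by_cases hCM : IsCMField K
    · exact cmCell h27 hCM
    · exact hmix F K hF hdeg h1 hCM

theorem mixed_of_rung (h : OneComplexPlaceSatakeA2) : MixedOneComplexPlaceSatakeA2 :=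
  fun F K _ _ _ _ _ hF hdeg hc _ => h F K hF hdeg hc.le

/-! ## 4. ON PATH: the top `E` and the summit imply every cell (sorry-free) -/

/-- The ladder's top, a REDUCIBLE alias of the crux decl (item stmt-Langlands-14328). -/
abbrev TopCrux : Prop :=
  Summit.Langlands.Langlands.Theses.OrdinaryPrimeTransport.ReciprocityUpToIrreducibility

example : TopCrux ↔ Summit.Langlands.Langlands.Theses.OrdinaryPrimeTransport.ReciprocityUpToIrreducibility :=
  Iff.rfl

/-- `E ⟹ every cell`: clause (A) of `E` gives `Corresponds Rec ι π.1 ρ`, whose first conjunct is the a.e.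
Satake/Frobenius compatibility. [folklore] -/
theorem family_of_top (c : ℕ) (hE : TopCrux) : WindowSatakeA2 c := by
  intro F K _ _ _ _ _ _ _ _ hcpt π hL _ ℓ _ ι
  obtain ⟨Rec, hall⟩ := hE K
  obtain ⟨ρ, -, hcorr⟩ := (hall 2 two_pos hcpt).1 π hL ℓ ι
  exact ⟨ρ, hcorr.1⟩

/-- `Langlands ⟹ every cell` (via clause (A) `AutomorphicToGalois` of the summit for any reciprocity datum,
which exists by the summit's `Nonempty` conjunct). [folklore] -/
theorem family_of_langlands (c : ℕ) (hL : _root_.Langlands) : WindowSatakeA2 c := by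
  intro F K _ _ _ _ _ _ _ _ hcpt π hLalg _ ℓ _ ι
  obtain ⟨⟨Rec⟩, hall⟩ := hL K
  have hA : AutomorphicToGalois 2 Rec hcpt := (hall Rec 2 two_pos hcpt).1
  obtain ⟨ρ, -, -, hcorr, -⟩ := hA π hLalg ℓ ι
  exact ⟨ρ, hcorr.1⟩

/-- **F4 on-path lemma**: `Langlands → OneComplexPlaceSatakeA2`. [folklore] -/
@[aesop safe apply]
theorem OneComplexPlaceSatakeA2_of_Langlands (hL : _root_.Langlands) : OneComplexPlaceSatakeA2 :=
  family_of_langlands 1 hL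

theorem OneComplexPlaceSatakeA2_of_top (hE : TopCrux) : OneComplexPlaceSatakeA2 :=
  family_of_top 1 hE

/-! ## 5. The cells above the rung, the window upgrade, the off-window residual -/

/-- **The cells above the rung** (`c ≥ 2` complex places: windows `K/F` in which at least two real places
of `F` ramify, up to and including the CM cell). -/
def HigherWindows : Prop :=
  ∀ (F K : Type) [Field F] [NumberField F] [Field K] [NumberField K] [Algebra F K],
    IsTotallyReal F → Module.finrank F K = 2 → 2 ≤ NumberField.InfinitePlace.nrComplexPlaces K →
      RegularSatakeA2 K

/-- Rung + higher cells = the family at every `c` (sorry-free glue). [folklore] -/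
theorem family_all_of (hr : OneComplexPlaceSatakeA2) (hh : HigherWindows) (c : ℕ) : WindowSatakeA2 c := by
  intro F K _ _ _ _ _ hF hdeg _
  by_cases h1 : NumberField.InfinitePlace.nrComplexPlaces K ≤ 1
  · exact hr F K hF hdeg h1
  · exact hh F K hF hdeg (by omega)

/-- The whole family = the cell body over every window field. [folklore] -/
theorem window_of_family (h : ∀ c, WindowSatakeA2 c) {K : Type} [Field K] [NumberField K]
    (hK : IsQuadraticWindow K) : RegularSatakeA2 K := by
  obtain ⟨F, _, _, _, hF, hdeg⟩ := hK
  exact h _ F K hF hdeg le_rfl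

/-- **Full clause (A) of `E` on the window sector** (`n = 2`, regular `π`, `K` a window field), for EVERY
reciprocity datum `Rec` (all of them carry Henniart's canonical local Langlands, `ReciprocityData`):
`IsGeometricFramed Rec ρ` (a.e. unramified, de Rham at `v ∣ ℓ` for `Rec.pst`) and `Corresponds Rec ι π.1 ρ`
(a.e. Satake + local–global compatibility at EVERY place). -/
def WindowCorrespondenceA2 : Prop :=
  ∀ (K : Type) [Field K] [NumberField K], IsQuadraticWindow K → ∀ (Rec : ReciprocityData K)
    (hcpt : isCompact_glFiniteIntegralLevel 2 K) (π : CuspidalAutomorphicRepData 2 K hcpt),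
    π.1.IsLAlgebraic → (∃ T : InfinityType K 2, π.1.HasInfinityType T ∧ T.IsRegular) →
      ∀ (ℓ : ℕ) [Fact ℓ.Prime] (ι : PadicAlgCl ℓ ≃+* ℂ),
        ∃ ρ : FramedGaloisRep K (PadicAlgCl ℓ) 2, IsGeometricFramed Rec ρ ∧ Corresponds Rec ι π.1 ρ

/-- **The window upgrade step** (a.e. Satake ⟹ full clause (A) on the window sector): from the family at
every `c` to `WindowCorrespondenceA2` — de Rham / crystalline at `v ∣ ℓ` and local–global compatibility at
every finite place for representations built by congruences (honest, itself open for the mixed windows: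
Mok 2014 Thm. 1.1 reaches compatibility up to semisimplification at `w ∤ p` and Hodge–Tate at `p` over CM
`E/F` only). -/
def WindowUpgrade : Prop :=
  (∀ (K : Type) [Field K] [NumberField K], IsQuadraticWindow K → RegularSatakeA2 K) →
    WindowCorrespondenceA2

/-- **The window sector of `E`'s clause (A)**: `n = 2`, `K` a window field, `π` regular. -/
def InWindowSector (n : ℕ) (K : Type) [Field K] [NumberField K]
    (hcpt : isCompact_glFiniteIntegralLevel n K) (π : CuspidalAutomorphicRepData n K hcpt) : Prop :=
  n = 2 ∧ IsQuadraticWindow K ∧ ∃ T : InfinityType K n, π.1.HasInfinityType T ∧ T.IsRegular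

/-- **Off-window residual**: `E` with clause (A) restricted to the COMPLEMENT of the window sector (every
other `n`, every non-window `K`, every irregular `π`) and clause (B) entire — the declared residual of this
line (summit-hard; not where the line directs provers). -/
def OffWindowReciprocity : Prop :=
  ∀ (K : Type) [Field K] [NumberField K], ∃ Rec : ReciprocityData K, ∀ n : ℕ, 0 < n →
    ∀ hcpt : isCompact_glFiniteIntegralLevel n K,
      (∀ π : CuspidalAutomorphicRepData n K hcpt, π.1.IsLAlgebraic → ¬ InWindowSector n K hcpt π →
        ∀ (ℓ : ℕ) [Fact ℓ.Prime] (ι : PadicAlgCl ℓ ≃+* ℂ),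
          ∃ ρ : FramedGaloisRep K (PadicAlgCl ℓ) n, IsGeometricFramed Rec ρ ∧ Corresponds Rec ι π.1 ρ) ∧
      GaloisToAutomorphic n Rec hcpt

/-- `E ⟹` the residual (it is a restriction of `E`). [folklore] -/
theorem offWindow_of_top (hE : TopCrux) : OffWindowReciprocity := by
  intro K _ _
  obtain ⟨Rec, hall⟩ := hE K
  exact ⟨Rec, fun n hn hcpt => ⟨fun π hL _ ℓ _ ι => (hall n hn hcpt).1 π hL ℓ ι, (hall n hn hcpt).2⟩⟩

/-- `E ⟹` the window correspondence for the datum `E` provides — NOT for every `Rec`; recorded only to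
show where `WindowUpgrade` exceeds a restriction of `E` (the `∀ Rec`, harmless since `ReciprocityData` is
Henniart-pinned). [folklore] -/
theorem windowCorrespondence_exists_of_top (hE : TopCrux) (K : Type) [Field K] [NumberField K] :
    ∃ Rec : ReciprocityData K, ∀ (hcpt : isCompact_glFiniteIntegralLevel 2 K)
      (π : CuspidalAutomorphicRepData 2 K hcpt), π.1.IsLAlgebraic →
        ∀ (ℓ : ℕ) [Fact ℓ.Prime] (ι : PadicAlgCl ℓ ≃+* ℂ),
          ∃ ρ : FramedGaloisRep K (PadicAlgCl ℓ) 2, IsGeometricFramed Rec ρ ∧ Corresponds Rec ι π.1 ρ := by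
  obtain ⟨Rec, hall⟩ := hE K
  exact ⟨Rec, fun hcpt π hL ℓ _ ι => (hall 2 two_pos hcpt).1 π hL ℓ ι⟩

/-! ## 6. Composition in hypothesis form (no sorry): `Rung → Gap → Upgrade → OffWindow → E` BY NAME -/

/-- **COMPOSITION IN HYPOTHESIS FORM** — the crux decl from the four statements. -/
theorem ReciprocityUpToIrreducibility_of :
    OneComplexPlaceSatakeA2 → HigherWindows → WindowUpgrade → OffWindowReciprocity → TopCrux := by
  intro hr hh hup hoff K _ _
  obtain ⟨Rec, hall⟩ := hoff K
  refine ⟨Rec, fun n hn hcpt => ⟨?_, (hall n hn hcpt).2⟩⟩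
  intro π hL ℓ _ ι
  by_cases hsec : InWindowSector n K hcpt π
  · obtain ⟨h2, hK, hreg⟩ := hsec
    subst h2
    exact hup (fun K' _ _ hK' => window_of_family (family_all_of hr hh) hK') K hK Rec hcpt π hL hreg ℓ ι
  · exact (hall n hn hcpt).1 π hL hsec ℓ ι

/-! ## 7. Registered stubs (the ONLY `sorry`s of this file) -/

/-- **stub 1 — THE RUNG** (cap-lifting step of the ladder; by `rung_of_mixed` it suffices, given lang.S27,
to prove `MixedOneComplexPlaceSatakeA2`). -/
theorem stub_rung : OneComplexPlaceSatakeA2 := by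
  sorry

/-- **stub 2 — the cells above the rung** (`c ≥ 2` complex places). -/
theorem stub_higherWindows : HigherWindows := by
  sorry

/-- **stub 3 — the window upgrade** (a.e. Satake ⟹ `IsGeometricFramed ∧ Corresponds` on the window sector). -/
theorem stub_windowUpgrade : WindowUpgrade := by
  sorry

/-- **stub 4 — the off-window residual** (declared residual; summit-hard). -/
theorem stub_offWindow : OffWindowReciprocity := by
  sorry

/-! ## 8. The skeleton theorem: the item's decl BY NAME, sorries only in the four stubs -/

theorem ReciprocityUpToIrreducibility_proof :
    Summit.Langlands.Langlands.Theses.OrdinaryPrimeTransport.ReciprocityUpToIrreducibility :=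
  ReciprocityUpToIrreducibility_of stub_rung stub_higherWindows stub_windowUpgrade stub_offWindow

#print axioms ReciprocityUpToIrreducibility_of
#print axioms floor_zero
#print axioms rung_of_mixed
#print axioms OneComplexPlaceSatakeA2_of_Langlands

end Summit.Langlands.Langlands.Cruxes.ReciprocityUpToIrreducibility.OneComplexPlaceSatakeA2

end
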